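import Mathlib

/-!
# Crux-triage certificates (stmt-ABC-1975 `SharpModerateLaw`, round 1, triager 2)

The three TYPED transfer laws offered by the round-1 idea cards are false as typed.
Each `def` below is a VERBATIM copy of the corresponding declaration in
`lean/Summits/ABC/ABC/Cruxes/SharpModerateLaw/Ideator{2,3}Sketch.lean` (those modules are not
built on the farm and cannot be imported); only the namespace differs.

* `not_BoxRadicalLaw` — `Sketch.BoxRadicalLaw` (cards `euclidean-stratum-mordell-orbit`,
  `frey-kloosterman-census-sqrt-line`): refuted at `λ = 1/3, ε = 1/12` by the axis family
  `(0, y)`, `1 ≤ y ≤ T^{1/3}` (the `j = 0` curves `c₄ = 0`, triage BUG 1).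
* `not_BoxRadicalLaw'` — the same law with `x ≠ 0 ∧ y ≠ 0` added: still false, at
  `λ = 1/5, ε = 1/120`, by the family `(t², t³ + 1)`, `t ≤ T^{7/120}` (the box is CUMULATIVE
  in `M⁺ = max(|x|³, y²)` while the bound `T^{λ-1/6}` is the dyadic prediction).
* `not_CuspCountLaw` — `Ideator2.CuspCountLaw σ` for every `σ ≥ 6` (cards
  `deep-moduli-cusp-dispersion`, `two-division-index-form`, `three-descent-quadratic-roots`):
  `cuspSet X Y` is cumulative in `Y` but the bound `X·Y^{-1/6} + 1` decays; witness family
  `(12a, 72)`, `2 ≤ a ≤ X^{1/6}`, at `Y = X⁶`, `ε = 1/12`. Hence `Ideator2.Transfer` is vacuous.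
* `not_IndexFormCensus` — `Ideator2.IndexFormCensus σ`, `σ ≥ 6` (card `two-division-index-form`):
  the Lean statement drops the card's `H·G ≠ 0` clause, so the `j = 1728` forms `(1,0,-m,0)`
  (`G(1,0) = 0`) give `≍ X^{1/4}`… members at `Y = X⁶` against `C·X^{1/12}·2`.
-/

namespace CruxTriage.R1K2

open UniqueFactorizationMonoid

/-! ## Real-power bookkeeping -/

lemma rpow_pow_inv (k : ℕ) (a n : ℕ) (hn : n ≠ 0) :
    (((k : ℝ) ^ a) ^ n) ^ ((n : ℝ)⁻¹) = (k : ℝ) ^ a :=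
  Real.pow_rpow_inv_natCast (by positivity) hn

/-! ## 1. `BoxRadicalLaw` (Ideator 3) -/

/-- verbatim copy of `Summit.ABC.ABC.Cruxes.SharpModerateLaw.Sketch.BoxRadicalLaw`. -/
def BoxRadicalLaw : Prop :=
  ∀ lam ε : ℝ, 1 / 6 < lam → lam ≤ 1 / 3 → 0 < ε → ∃ C : ℝ, ∀ T : ℝ, 1 ≤ T →
    (Set.ncard {p : ℤ × ℤ | p.1 ^ 3 ≠ p.2 ^ 2 ∧ (|(p.1 : ℝ)|) ^ 3 ≤ T ∧ ((p.2 : ℝ)) ^ 2 ≤ T ∧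
        ((radical (M := ℕ) ((p.1 ^ 3 - p.2 ^ 2).natAbs) : ℕ) : ℝ) ≤ T ^ lam} : ℝ)
      ≤ C * T ^ (lam - 1 / 6 + ε)

/-- The same law with the axes removed (`x ≠ 0`, `y ≠ 0`), to show that excluding the CM
families does not rescue it. -/
def BoxRadicalLaw' : Prop :=
  ∀ lam ε : ℝ, 1 / 6 < lam → lam ≤ 1 / 3 → 0 < ε → ∃ C : ℝ, ∀ T : ℝ, 1 ≤ T →
    (Set.ncard {p : ℤ × ℤ | p.1 ≠ 0 ∧ p.2 ≠ 0 ∧ p.1 ^ 3 ≠ p.2 ^ 2 ∧ (|(p.1 : ℝ)|) ^ 3 ≤ T ∧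
        ((p.2 : ℝ)) ^ 2 ≤ T ∧
        ((radical (M := ℕ) ((p.1 ^ 3 - p.2 ^ 2).natAbs) : ℕ) : ℝ) ≤ T ^ lam} : ℝ)
      ≤ C * T ^ (lam - 1 / 6 + ε)

/-- The generic box set (with a real bound `B` for the radical). -/
def boxSet (T B : ℝ) : Set (ℤ × ℤ) :=
  {p : ℤ × ℤ | p.1 ^ 3 ≠ p.2 ^ 2 ∧ (|(p.1 : ℝ)|) ^ 3 ≤ T ∧ ((p.2 : ℝ)) ^ 2 ≤ T ∧
        ((radical (M := ℕ) ((p.1 ^ 3 - p.2 ^ 2).natAbs) : ℕ) : ℝ) ≤ B}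

/-- The box set of `BoxRadicalLaw'` (axes removed). -/
def boxSet' (T B : ℝ) : Set (ℤ × ℤ) :=
  {p : ℤ × ℤ | p.1 ≠ 0 ∧ p.2 ≠ 0 ∧ p.1 ^ 3 ≠ p.2 ^ 2 ∧ (|(p.1 : ℝ)|) ^ 3 ≤ T ∧
        ((p.2 : ℝ)) ^ 2 ≤ T ∧
        ((radical (M := ℕ) ((p.1 ^ 3 - p.2 ^ 2).natAbs) : ℕ) : ℝ) ≤ B}

lemma abs_le_of_cube_le {x T : ℝ} (hT : 1 ≤ T) (h : |x| ^ 3 ≤ T) : |x| ≤ T := by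
  rcases le_or_gt |x| 1 with h1 | h1
  · exact h1.trans hT
  · have h2 : 0 ≤ |x| * (|x| ^ 2 - 1) := mul_nonneg (abs_nonneg _) (by nlinarith)
    nlinarith [h2]

lemma abs_le_of_sq_le {y T : ℝ} (hT : 1 ≤ T) (h : y ^ 2 ≤ T) : |y| ≤ T := by
  rcases le_or_gt |y| 1 with h1 | h1
  · exact h1.trans hT
  · have h2 : 0 ≤ |y| * (|y| - 1) := mul_nonneg (abs_nonneg _) (by linarith)
    have h3 : |y| ^ 2 = y ^ 2 := sq_abs y
    nlinarith [h2, h3]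

lemma boxSet_finite (T B : ℝ) (hT : 1 ≤ T) : (boxSet T B).Finite := by
  set N : ℕ := Nat.ceil T with hN
  have hTN : T ≤ N := Nat.le_ceil T
  refine (Set.Finite.prod (Set.finite_Icc (-(N : ℤ)) N) (Set.finite_Icc (-(N : ℤ)) N)).subset ?_
  rintro ⟨x, y⟩ ⟨-, hx, hy, -⟩
  simp only [Set.mem_prod, Set.mem_Icc]
  have hx' : |(x : ℝ)| ≤ N := (abs_le_of_cube_le hT hx).trans hTN
  have hy' : |(y : ℝ)| ≤ N := (abs_le_of_sq_le hT hy).trans hTN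
  have hx'' : |x| ≤ (N : ℤ) := by exact_mod_cast hx'
  have hy'' : |y| ≤ (N : ℤ) := by exact_mod_cast hy'
  exact ⟨⟨(abs_le.mp hx'').1, (abs_le.mp hx'').2⟩, ⟨(abs_le.mp hy'').1, (abs_le.mp hy'').2⟩⟩

lemma radical_natAbs_le (n : ℤ) (hn : n ≠ 0) :
    (radical (M := ℕ) n.natAbs : ℕ) ≤ n.natAbs :=
  Nat.le_of_dvd (Int.natAbs_pos.mpr hn) radical_dvd_self

theorem not_BoxRadicalLaw : ¬ BoxRadicalLaw := by
  intro h
  obtain ⟨C, hC⟩ := h (1 / 3) (1 / 12) (by norm_num) (by norm_num) (by norm_num)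
  obtain ⟨k, hkC, hk1⟩ : ∃ k : ℕ, C < k ∧ 1 ≤ k := by
    refine ⟨Nat.ceil C + 1, ?_, by omega⟩
    push_cast
    linarith [Nat.le_ceil C]
  have hk1R : (1 : ℝ) ≤ k := by exact_mod_cast hk1
  have hT1 : (1 : ℝ) ≤ (k : ℝ) ^ 12 := one_le_pow₀ hk1R
  have hmain := hC ((k : ℝ) ^ 12) hT1
  have e1 : ((k : ℝ) ^ 12) ^ ((1 : ℝ) / 3) = (k : ℝ) ^ 4 := by
    rw [show ((1 : ℝ) / 3) = ((3 : ℕ) : ℝ)⁻¹ by norm_num,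
      show (k : ℝ) ^ 12 = ((k : ℝ) ^ 4) ^ 3 by ring]
    exact rpow_pow_inv k 4 3 (by norm_num)
  have e2 : ((k : ℝ) ^ 12) ^ ((1 : ℝ) / 3 - 1 / 6 + 1 / 12) = (k : ℝ) ^ 3 := by
    rw [show ((1 : ℝ) / 3 - 1 / 6 + 1 / 12) = ((4 : ℕ) : ℝ)⁻¹ by norm_num,
      show (k : ℝ) ^ 12 = ((k : ℝ) ^ 3) ^ 4 by ring]
    exact rpow_pow_inv k 3 4 (by norm_num)
  rw [e2, e1] at hmain
  -- `hmain` now speaks about `boxSet (k^12) (k^4)`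
  have hmain' : ((boxSet ((k : ℝ) ^ 12) ((k : ℝ) ^ 4)).ncard : ℝ) ≤ C * (k : ℝ) ^ 3 := hmain
  -- the explicit family `(0, y)`, `1 ≤ y ≤ k ^ 4`
  let F : Finset (ℤ × ℤ) := (Finset.Icc (1 : ℤ) ((k : ℤ) ^ 4)).image (fun y => ((0 : ℤ), y))
  have hFinj : Function.Injective (fun y : ℤ => ((0 : ℤ), y)) := fun a b hab => by
    simpa using hab
  have hFcard : F.card = k ^ 4 := by
    rw [Finset.card_image_of_injective _ hFinj, Int.card_Icc,
      show ((k : ℤ)) ^ 4 + 1 - 1 = ((k ^ 4 : ℕ) : ℤ) by push_cast; ring]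
    exact Int.toNat_natCast _
  have hFsub : (F : Set (ℤ × ℤ)) ⊆ boxSet ((k : ℝ) ^ 12) ((k : ℝ) ^ 4) := by
    intro p hp
    simp only [F, Finset.coe_image, Finset.coe_Icc, Set.mem_image, Set.mem_Icc] at hp
    obtain ⟨y, ⟨hy1, hy2⟩, rfl⟩ := hp
    have hy0 : y ≠ 0 := by omega
    have hy0R : (0 : ℝ) ≤ y := by exact_mod_cast (by omega : (0 : ℤ) ≤ y)
    have hyR : (y : ℝ) ≤ (k : ℝ) ^ 4 := by exact_mod_cast hy2
    simp only [boxSet, Set.mem_setOf_eq]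
    refine ⟨?_, ?_, ?_, ?_⟩
    · intro h0
      have : y ^ 2 = 0 := by rw [← h0]; ring
      exact hy0 (pow_eq_zero_iff (by norm_num) |>.mp this)
    · simp only [Int.cast_zero, abs_zero]
      rw [zero_pow (by norm_num)]
      positivity
    · calc (y : ℝ) ^ 2 ≤ ((k : ℝ) ^ 4) ^ 2 := by gcongr
        _ = (k : ℝ) ^ 8 := by ring
        _ ≤ (k : ℝ) ^ 12 := pow_le_pow_right₀ hk1R (by norm_num)
    · have hrad : (radical (M := ℕ) (((0 : ℤ) ^ 3 - y ^ 2).natAbs)) ≤ y.natAbs := by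
        have hab : ((0 : ℤ) ^ 3 - y ^ 2).natAbs = y.natAbs ^ 2 := by
          simp [Int.natAbs_neg, Int.natAbs_pow]
        rw [hab, radical_pow _ (by norm_num)]
        exact Nat.le_of_dvd (Int.natAbs_pos.mpr hy0) radical_dvd_self
      have hradR : ((radical (M := ℕ) (((0 : ℤ) ^ 3 - y ^ 2).natAbs) : ℕ) : ℝ) ≤ (y.natAbs : ℝ) := by
        exact_mod_cast hrad
      have hyabs : (y.natAbs : ℝ) = (y : ℝ) := by
        rw [Nat.cast_natAbs, Int.cast_abs, abs_of_nonneg hy0R]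
      calc _ ≤ (y.natAbs : ℝ) := hradR
        _ = y := hyabs
        _ ≤ (k : ℝ) ^ 4 := hyR
  have hfin := boxSet_finite ((k : ℝ) ^ 12) ((k : ℝ) ^ 4) hT1
  have hle := Set.ncard_le_ncard hFsub hfin
  rw [Set.ncard_coe_finset, hFcard] at hle
  have h4 : (k : ℝ) ^ 4 ≤ C * (k : ℝ) ^ 3 := by
    calc (k : ℝ) ^ 4 = ((k ^ 4 : ℕ) : ℝ) := by push_cast; ring
      _ ≤ ((boxSet ((k : ℝ) ^ 12) ((k : ℝ) ^ 4)).ncard : ℝ) := by exact_mod_cast hle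
      _ ≤ C * (k : ℝ) ^ 3 := hmain'
  have hk3 : (0 : ℝ) < (k : ℝ) ^ 3 := by positivity
  have : (k : ℝ) * (k : ℝ) ^ 3 ≤ C * (k : ℝ) ^ 3 := by
    calc (k : ℝ) * (k : ℝ) ^ 3 = (k : ℝ) ^ 4 := by ring
      _ ≤ C * (k : ℝ) ^ 3 := h4
  have : (k : ℝ) ≤ C := le_of_mul_le_mul_right this hk3
  linarith

theorem not_BoxRadicalLaw' : ¬ BoxRadicalLaw' := by
  intro h
  obtain ⟨C, hC⟩ := h (1 / 5) (1 / 120) (by norm_num) (by norm_num) (by norm_num)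
  obtain ⟨s, hsC, hs2⟩ : ∃ s : ℕ, C < s ∧ 2 ≤ s := by
    refine ⟨Nat.ceil C + 2, ?_, by omega⟩
    push_cast
    linarith [Nat.le_ceil C]
  have hs1R : (1 : ℝ) ≤ s := by exact_mod_cast (by omega : 1 ≤ s)
  have hs2R : (2 : ℝ) ≤ s := by exact_mod_cast hs2
  have hT1 : (1 : ℝ) ≤ (s : ℝ) ^ 120 := one_le_pow₀ hs1R
  have hmain := hC ((s : ℝ) ^ 120) hT1
  have e1 : ((s : ℝ) ^ 120) ^ ((1 : ℝ) / 5) = (s : ℝ) ^ 24 := by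
    rw [show ((1 : ℝ) / 5) = ((5 : ℕ) : ℝ)⁻¹ by norm_num,
      show (s : ℝ) ^ 120 = ((s : ℝ) ^ 24) ^ 5 by ring]
    exact rpow_pow_inv s 24 5 (by norm_num)
  have e2 : ((s : ℝ) ^ 120) ^ ((1 : ℝ) / 5 - 1 / 6 + 1 / 120) = (s : ℝ) ^ 5 := by
    rw [show ((1 : ℝ) / 5 - 1 / 6 + 1 / 120) = ((24 : ℕ) : ℝ)⁻¹ by norm_num,
      show (s : ℝ) ^ 120 = ((s : ℝ) ^ 5) ^ 24 by ring]
    exact rpow_pow_inv s 5 24 (by norm_num)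
  rw [e2, e1] at hmain
  -- the family `(t², t³+1)`, `1 ≤ t ≤ s ^ 7`
  let f : ℤ → ℤ × ℤ := fun t => (t ^ 2, t ^ 3 + 1)
  let F : Finset (ℤ × ℤ) := (Finset.Icc (1 : ℤ) ((s : ℤ) ^ 7)).image f
  have hFinj : Set.InjOn f (Finset.Icc (1 : ℤ) ((s : ℤ) ^ 7)) := by
    intro a ha b hb hab
    simp only [f, Prod.mk.injEq] at hab
    have h3 : a ^ 3 = b ^ 3 := by linarith [hab.2]
    have ha0 : 0 ≤ a := by
      simp only [Finset.coe_Icc, Set.mem_Icc] at ha; omega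
    have hb0 : 0 ≤ b := by
      simp only [Finset.coe_Icc, Set.mem_Icc] at hb; omega
    exact le_antisymm (by nlinarith [hab.1, sq_nonneg (a - b), sq_nonneg (a + b)])
      (by nlinarith [hab.1, sq_nonneg (a - b), sq_nonneg (a + b)])
  have hFcard : F.card = s ^ 7 := by
    rw [Finset.card_image_of_injOn hFinj, Int.card_Icc,
      show ((s : ℤ)) ^ 7 + 1 - 1 = ((s ^ 7 : ℕ) : ℤ) by push_cast; ring]
    exact Int.toNat_natCast _
  -- the target set is `boxSet' (s^120) (s^24)`
  have hmain' : ((boxSet' ((s : ℝ) ^ 120) ((s : ℝ) ^ 24)).ncard : ℝ) ≤ C * (s : ℝ) ^ 5 := hmain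
  have hSsub : boxSet' ((s : ℝ) ^ 120) ((s : ℝ) ^ 24) ⊆ boxSet ((s : ℝ) ^ 120) ((s : ℝ) ^ 24) := by
    rintro p ⟨-, -, h1, h2, h3, h4⟩
    exact ⟨h1, h2, h3, h4⟩
  have hfin : (boxSet' ((s : ℝ) ^ 120) ((s : ℝ) ^ 24)).Finite := (boxSet_finite _ _ hT1).subset hSsub
  have hs21 : (3 : ℤ) ≤ (s : ℤ) ^ 3 := by
    have : (2 : ℤ) ≤ s := by exact_mod_cast hs2
    calc (3 : ℤ) ≤ 2 ^ 3 := by norm_num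
      _ ≤ (s : ℤ) ^ 3 := by gcongr
  have hFsub : (F : Set (ℤ × ℤ)) ⊆ boxSet' ((s : ℝ) ^ 120) ((s : ℝ) ^ 24) := by
    intro p hp
    simp only [F, Finset.coe_image, Finset.coe_Icc, Set.mem_image, Set.mem_Icc] at hp
    obtain ⟨t, ⟨ht1, ht2⟩, rfl⟩ := hp
    have ht0 : (0 : ℤ) ≤ t := by omega
    have htR1 : (1 : ℝ) ≤ t := by exact_mod_cast ht1
    have htR : (t : ℝ) ≤ (s : ℝ) ^ 7 := by exact_mod_cast ht2
    have hkey : (t ^ 2) ^ 3 - (t ^ 3 + 1) ^ 2 = -(2 * t ^ 3 + 1) := by ring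
    simp only [boxSet', Set.mem_setOf_eq, f]
    refine ⟨?_, ?_, ?_, ?_, ?_, ?_⟩
    · positivity
    · positivity
    · rw [ne_eq, ← sub_eq_zero, hkey]
      have : (0 : ℤ) < 2 * t ^ 3 + 1 := by positivity
      intro h0; linarith
    · push_cast
      rw [abs_of_nonneg (by positivity)]
      calc ((t : ℝ) ^ 2) ^ 3 = (t : ℝ) ^ 6 := by ring
        _ ≤ ((s : ℝ) ^ 7) ^ 6 := by gcongr
        _ = (s : ℝ) ^ 42 := by ring
        _ ≤ (s : ℝ) ^ 120 := pow_le_pow_right₀ hs1R (by norm_num)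
    · push_cast
      have h1 : (t : ℝ) ^ 3 + 1 ≤ 2 * (s : ℝ) ^ 21 := by
        have : (t : ℝ) ^ 3 ≤ ((s : ℝ) ^ 7) ^ 3 := by gcongr
        have h1' : (1 : ℝ) ≤ (s : ℝ) ^ 21 := one_le_pow₀ hs1R
        nlinarith
      calc ((t : ℝ) ^ 3 + 1) ^ 2 ≤ (2 * (s : ℝ) ^ 21) ^ 2 := by gcongr
        _ = 4 * (s : ℝ) ^ 42 := by ring
        _ ≤ (s : ℝ) ^ 2 * (s : ℝ) ^ 42 := by
            have hs4 : (4 : ℝ) ≤ (s : ℝ) ^ 2 := by nlinarith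
            gcongr
        _ = (s : ℝ) ^ 44 := by ring
        _ ≤ (s : ℝ) ^ 120 := pow_le_pow_right₀ hs1R (by norm_num)
    · rw [hkey, Int.natAbs_neg]
      have hpos : (0 : ℤ) < 2 * t ^ 3 + 1 := by positivity
      have hrad : (radical (M := ℕ) ((2 * t ^ 3 + 1).natAbs) : ℕ) ≤ (2 * t ^ 3 + 1).natAbs :=
        radical_natAbs_le _ hpos.ne'
      have hbound : 2 * t ^ 3 + 1 ≤ (s : ℤ) ^ 24 := by
        have : t ^ 3 ≤ ((s : ℤ) ^ 7) ^ 3 := by gcongr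
        calc 2 * t ^ 3 + 1 ≤ 3 * t ^ 3 := by nlinarith [pow_pos (show (0:ℤ) < t by omega) 3]
          _ ≤ 3 * ((s : ℤ) ^ 7) ^ 3 := by gcongr
          _ = 3 * (s : ℤ) ^ 21 := by ring
          _ ≤ (s : ℤ) ^ 3 * (s : ℤ) ^ 21 := by gcongr
          _ = (s : ℤ) ^ 24 := by ring
      have hN : (2 * t ^ 3 + 1).natAbs ≤ s ^ 24 := by
        have h' : ((2 * t ^ 3 + 1).natAbs : ℤ) ≤ ((s ^ 24 : ℕ) : ℤ) := by
          rw [Int.natAbs_of_nonneg hpos.le]; push_cast; exact hbound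
        exact_mod_cast h'
      have hfinal := (Nat.cast_le (α := ℝ)).mpr (hrad.trans hN)
      refine hfinal.trans_eq ?_
      push_cast; ring
  have hle := Set.ncard_le_ncard hFsub hfin
  rw [Set.ncard_coe_finset, hFcard] at hle
  have h7 : (s : ℝ) ^ 7 ≤ C * (s : ℝ) ^ 5 := by
    calc (s : ℝ) ^ 7 = ((s ^ 7 : ℕ) : ℝ) := by push_cast; ring
      _ ≤ ((boxSet' ((s : ℝ) ^ 120) ((s : ℝ) ^ 24)).ncard : ℝ) := by exact_mod_cast hle
      _ ≤ C * (s : ℝ) ^ 5 := hmain'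
  have hs5 : (0 : ℝ) < (s : ℝ) ^ 5 := by positivity
  have : (s : ℝ) ^ 2 * (s : ℝ) ^ 5 ≤ C * (s : ℝ) ^ 5 := by
    calc (s : ℝ) ^ 2 * (s : ℝ) ^ 5 = (s : ℝ) ^ 7 := by ring
      _ ≤ C * (s : ℝ) ^ 5 := h7
  have h2 : (s : ℝ) ^ 2 ≤ C := le_of_mul_le_mul_right this hs5
  nlinarith

/-! ## 2. `CuspCountLaw` (Ideator 2) -/

/-- verbatim copy of `Summit.ABC.ABC.Cruxes.SharpModerateLaw.Ideator2.TF`. -/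
def TF (x : ℤ × ℤ) : Prop :=
  (∀ p : ℕ, p.Prime → 5 ≤ p → ¬ ((p : ℤ) ^ 4 ∣ x.1 ∧ (p : ℤ) ^ 6 ∣ x.2)) ∧
  ¬ ((2 : ℤ) ^ 8 ∣ x.1 ∧ (2 : ℤ) ^ 11 ∣ x.2) ∧ ¬ ((3 : ℤ) ^ 5 ∣ x.1 ∧ (3 : ℤ) ^ 9 ∣ x.2)

/-- verbatim copy of `Summit.ABC.ABC.Cruxes.SharpModerateLaw.Ideator2.Nstar`. -/
def Nstar (x : ℤ × ℤ) : ℕ :=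
  ∏ p ∈ ((x.1 ^ 3 - x.2 ^ 2) / 1728).natAbs.primeFactors, (if ((p : ℕ) : ℤ) ∣ x.1 then p ^ 2 else p)

/-- verbatim copy of `Summit.ABC.ABC.Cruxes.SharpModerateLaw.Ideator2.cuspSet`. -/
def cuspSet (X Y : ℝ) : Set (ℤ × ℤ) :=
  {x | x.1 ≠ 0 ∧ x.2 ≠ 0 ∧ x.1 ^ 3 ≠ x.2 ^ 2 ∧ (1728 : ℤ) ∣ x.1 ^ 3 - x.2 ^ 2 ∧ TF x ∧
    ((|x.1| ^ 3 : ℤ) : ℝ) ≤ Y ∧ ((|x.1 ^ 3 - x.2 ^ 2| : ℤ) : ℝ) ≤ 1728 * Y ∧ (Nstar x : ℝ) ≤ X}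

/-- verbatim copy of `Summit.ABC.ABC.Cruxes.SharpModerateLaw.Ideator2.CuspCountLaw`. -/
def CuspCountLaw (σ : ℝ) : Prop :=
  ∀ ε : ℝ, 0 < ε → ∃ C : ℝ, ∀ X Y : ℝ, 1 ≤ X → 1 ≤ Y → Y ≤ X ^ σ →
    (Set.ncard (cuspSet X Y) : ℝ) ≤ C * X ^ ε * (X * Y ^ (-(1 / 6 : ℝ)) + 1)

lemma cuspSet_finite (X Y : ℝ) (hY : 1 ≤ Y) : (cuspSet X Y).Finite := by
  have hY' : (1 : ℝ) ≤ 1729 * Y := by linarith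
  set N : ℕ := Nat.ceil (1729 * Y) with hN
  have hYN : 1729 * Y ≤ N := Nat.le_ceil _
  refine (Set.Finite.prod (Set.finite_Icc (-(N : ℤ)) N) (Set.finite_Icc (-(N : ℤ)) N)).subset ?_
  rintro ⟨x, y⟩ ⟨-, -, -, -, -, hx, hxy, -⟩
  simp only [Set.mem_prod, Set.mem_Icc]
  have hx1 : |(x : ℝ)| ^ 3 ≤ 1729 * Y := by
    have : (((|x| ^ 3 : ℤ)) : ℝ) = |(x : ℝ)| ^ 3 := by push_cast; rfl
    linarith [this ▸ hx]
  have hx' : |(x : ℝ)| ≤ N := (abs_le_of_cube_le hY' hx1).trans hYN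
  have hy1 : (y : ℝ) ^ 2 ≤ 1729 * Y := by
    have e : (((|x ^ 3 - y ^ 2| : ℤ)) : ℝ) = |(x : ℝ) ^ 3 - (y : ℝ) ^ 2| := by push_cast; rfl
    have h1 : |(x : ℝ) ^ 3 - (y : ℝ) ^ 2| ≤ 1728 * Y := e ▸ hxy
    have h2 : (x : ℝ) ^ 3 ≤ |(x : ℝ)| ^ 3 := by
      rw [← abs_pow]; exact le_abs_self _
    have h3 : (((|x| ^ 3 : ℤ)) : ℝ) = |(x : ℝ)| ^ 3 := by push_cast; rfl
    have h4 : |(x : ℝ)| ^ 3 ≤ Y := h3 ▸ hx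
    have h5 := (abs_le.mp h1).1
    nlinarith
  have hy' : |(y : ℝ)| ≤ N := (abs_le_of_sq_le hY' hy1).trans hYN
  have hx'' : |x| ≤ (N : ℤ) := by exact_mod_cast hx'
  have hy'' : |y| ≤ (N : ℤ) := by exact_mod_cast hy'
  exact ⟨⟨(abs_le.mp hx'').1, (abs_le.mp hx'').2⟩, ⟨(abs_le.mp hy'').1, (abs_le.mp hy'').2⟩⟩

/-- The witness family: `(12a, 72)` is the short model data `(c₄, c₆)` with
`c₄³ - c₆² = 1728 (a³ - 3)`. -/
lemma witness_mem_cuspSet (k : ℕ) (hk : 2 ≤ k) (a : ℤ) (ha1 : 2 ≤ a) (ha2 : a ≤ (k : ℤ) ^ 2) :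
    ((12 * a, 72) : ℤ × ℤ) ∈ cuspSet ((k : ℝ) ^ 12) ((k : ℝ) ^ 72) := by
  have hkZ : (2 : ℤ) ≤ k := by exact_mod_cast hk
  have hk1Z : (1 : ℤ) ≤ k := by omega
  have ha0 : (0 : ℤ) ≤ a := by omega
  have hcube : (8 : ℤ) ≤ a ^ 3 := by
    have := pow_le_pow_left₀ (by norm_num : (0 : ℤ) ≤ 2) ha1 3
    norm_num at this
    exact this
  have hkey : (12 * a) ^ 3 - (72 : ℤ) ^ 2 = 1728 * (a ^ 3 - 3) := by ring
  have hdiv : ((12 * a) ^ 3 - (72 : ℤ) ^ 2) / 1728 = a ^ 3 - 3 := by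
    rw [hkey]; generalize a ^ 3 - 3 = b; omega
  have ha3k : a ^ 3 ≤ (k : ℤ) ^ 6 := by
    calc a ^ 3 ≤ ((k : ℤ) ^ 2) ^ 3 := by gcongr
      _ = (k : ℤ) ^ 6 := by ring
  simp only [cuspSet, Set.mem_setOf_eq]
  refine ⟨by omega, by norm_num, ?_, ⟨a ^ 3 - 3, hkey⟩, ?_, ?_, ?_, ?_⟩
  · rw [ne_eq, ← sub_eq_zero, hkey]; omega
  · -- tower-freeness: `72` is divisible by no sixth power of a prime `≥ 5`, nor by 2¹¹, nor 3⁹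
    refine ⟨?_, ?_, ?_⟩
    · rintro p hp h5 ⟨-, h72⟩
      have hle : ((p : ℤ)) ^ 6 ≤ 72 := Int.le_of_dvd (by norm_num) h72
      have h5Z : (5 : ℤ) ≤ p := by exact_mod_cast h5
      have : (5 : ℤ) ^ 6 ≤ (p : ℤ) ^ 6 := by gcongr
      norm_num at this
      linarith
    · rintro ⟨-, h72⟩; revert h72; norm_num
    · rintro ⟨-, h72⟩; revert h72; norm_num
  · -- |12a|³ ≤ k⁷²
    have h66 : (1728 : ℤ) ≤ (k : ℤ) ^ 66 :=
      le_trans (by norm_num) (pow_le_pow_left₀ (by norm_num) hkZ 66)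
    have : |12 * a| ^ 3 ≤ (k : ℤ) ^ 72 := by
      calc |12 * a| ^ 3 = 1728 * a ^ 3 := by rw [abs_of_nonneg (by omega)]; ring
        _ ≤ 1728 * (k : ℤ) ^ 6 := by gcongr
        _ ≤ (k : ℤ) ^ 66 * (k : ℤ) ^ 6 := by gcongr
        _ = (k : ℤ) ^ 72 := by ring
    exact_mod_cast this
  · -- |Δ·1728| ≤ 1728 k⁷²
    have : |(12 * a) ^ 3 - (72 : ℤ) ^ 2| ≤ 1728 * (k : ℤ) ^ 72 := by
      rw [hkey, abs_of_nonneg (by omega)]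
      calc 1728 * (a ^ 3 - 3) ≤ 1728 * (k : ℤ) ^ 6 := by linarith
        _ ≤ 1728 * (k : ℤ) ^ 72 := by gcongr; omega
    exact_mod_cast this
  · -- N* ≤ (a³-3)² ≤ k¹²
    have hn0 : (a ^ 3 - 3).natAbs ≠ 0 := by
      rw [ne_eq, Int.natAbs_eq_zero]; omega
    have hnle : (a ^ 3 - 3).natAbs ≤ k ^ 6 := by
      have : ((a ^ 3 - 3).natAbs : ℤ) ≤ (k : ℤ) ^ 6 := by
        rw [Int.natAbs_of_nonneg (by omega)]; linarith
      exact_mod_cast this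
    have hN : Nstar (12 * a, 72) ≤ k ^ 12 := by
      unfold Nstar
      simp only [hdiv]
      calc (∏ p ∈ (a ^ 3 - 3).natAbs.primeFactors, if ((p : ℕ) : ℤ) ∣ 12 * a then p ^ 2 else p)
          ≤ ∏ p ∈ (a ^ 3 - 3).natAbs.primeFactors, p ^ 2 := by
            apply Finset.prod_le_prod (fun i _ => by positivity)
            intro p hp
            split_ifs
            · exact le_rfl
            · exact Nat.le_self_pow (by norm_num) p
        _ = (∏ p ∈ (a ^ 3 - 3).natAbs.primeFactors, p) ^ 2 := Finset.prod_pow _ 2 _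
        _ ≤ ((a ^ 3 - 3).natAbs) ^ 2 := by
            gcongr
            exact Nat.le_of_dvd (Nat.pos_of_ne_zero hn0) (Nat.prod_primeFactors_dvd _)
        _ ≤ (k ^ 6) ^ 2 := by gcongr
        _ = k ^ 12 := by ring
    exact_mod_cast hN

theorem not_CuspCountLaw (σ : ℝ) (hσ : 6 ≤ σ) : ¬ CuspCountLaw σ := by
  intro h
  obtain ⟨C, hC⟩ := h (1 / 12) (by norm_num)
  obtain ⟨k, hkC, hk2⟩ : ∃ k : ℕ, 2 * C + 2 < k ∧ 2 ≤ k := by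
    refine ⟨Nat.ceil (2 * C) + 3, ?_, by omega⟩
    push_cast
    linarith [Nat.le_ceil (2 * C)]
  have hk1R : (1 : ℝ) ≤ k := by exact_mod_cast (by omega : 1 ≤ k)
  have hkR : (0 : ℝ) < k := by positivity
  have hX1 : (1 : ℝ) ≤ (k : ℝ) ^ 12 := one_le_pow₀ hk1R
  have hY1 : (1 : ℝ) ≤ (k : ℝ) ^ 72 := one_le_pow₀ hk1R
  have hYX : (k : ℝ) ^ 72 ≤ ((k : ℝ) ^ 12) ^ σ := by
    calc (k : ℝ) ^ 72 = ((k : ℝ) ^ 12) ^ ((6 : ℕ) : ℝ) := by rw [Real.rpow_natCast]; ring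
      _ ≤ ((k : ℝ) ^ 12) ^ σ :=
          Real.rpow_le_rpow_of_exponent_le hX1 (by exact_mod_cast hσ)
  have hmain := hC ((k : ℝ) ^ 12) ((k : ℝ) ^ 72) hX1 hY1 hYX
  have e1 : ((k : ℝ) ^ 12) ^ ((1 : ℝ) / 12) = (k : ℝ) := by
    rw [show ((1 : ℝ) / 12) = ((12 : ℕ) : ℝ)⁻¹ by norm_num]
    have := rpow_pow_inv k 1 12 (by norm_num)
    simpa using this
  have e2 : ((k : ℝ) ^ 72) ^ (-(1 / 6 : ℝ)) = ((k : ℝ) ^ 12)⁻¹ := by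
    rw [Real.rpow_neg (by positivity), show ((1 : ℝ) / 6) = ((6 : ℕ) : ℝ)⁻¹ by norm_num,
      show (k : ℝ) ^ 72 = ((k : ℝ) ^ 12) ^ 6 by ring]
    rw [rpow_pow_inv k 12 6 (by norm_num)]
  have e3 : (k : ℝ) ^ 12 * ((k : ℝ) ^ 12)⁻¹ = 1 := mul_inv_cancel₀ (by positivity)
  rw [e1, e2, e3] at hmain
  -- hmain : ncard (cuspSet (k^12) (k^72)) ≤ C * k * (1 + 1)
  let f : ℤ → ℤ × ℤ := fun a => (12 * a, 72)
  let F : Finset (ℤ × ℤ) := (Finset.Icc (2 : ℤ) ((k : ℤ) ^ 2)).image f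
  have hFinj : Function.Injective f := fun a b hab => by
    simp only [f, Prod.mk.injEq] at hab; omega
  have hFcard : (F.card : ℝ) = (k : ℝ) ^ 2 - 1 := by
    rw [Finset.card_image_of_injective _ hFinj, Int.card_Icc]
    have hk2Z : (2 : ℤ) ≤ (k : ℤ) ^ 2 := by
      have : (2 : ℤ) ≤ k := by exact_mod_cast hk2
      nlinarith
    have : (((k : ℤ) ^ 2 + 1 - 2).toNat : ℤ) = (k : ℤ) ^ 2 - 1 := by
      rw [Int.toNat_of_nonneg (by omega)]; ring
    have h' : ((((k : ℤ) ^ 2 + 1 - 2).toNat : ℤ) : ℝ) = (((k : ℤ) ^ 2 - 1 : ℤ) : ℝ) := by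
      rw [this]
    push_cast at h'
    exact h'
  have hFsub : (F : Set (ℤ × ℤ)) ⊆ cuspSet ((k : ℝ) ^ 12) ((k : ℝ) ^ 72) := by
    intro p hp
    simp only [F, Finset.coe_image, Finset.coe_Icc, Set.mem_image, Set.mem_Icc] at hp
    obtain ⟨a, ⟨ha1, ha2⟩, rfl⟩ := hp
    exact witness_mem_cuspSet k hk2 a ha1 ha2
  have hfin := cuspSet_finite ((k : ℝ) ^ 12) ((k : ℝ) ^ 72) hY1
  have hle := Set.ncard_le_ncard hFsub hfin
  rw [Set.ncard_coe_finset] at hle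
  have hleR : (F.card : ℝ) ≤ ((cuspSet ((k : ℝ) ^ 12) ((k : ℝ) ^ 72)).ncard : ℝ) := by
    exact_mod_cast hle
  rw [hFcard] at hleR
  have h2 : (k : ℝ) ^ 2 - 1 ≤ C * k * (1 + 1) := hleR.trans hmain
  nlinarith

/-! ## 3. `IndexFormCensus` (Ideator 2, card two-division-index-form) -/

/-- verbatim copy of `Summit.ABC.ABC.Cruxes.SharpModerateLaw.Ideator2.IndexFormCensus`. -/
def IndexFormCensus (σ : ℝ) : Prop :=
  ∀ ε : ℝ, 0 < ε → ∃ C : ℝ, ∀ X Y : ℝ, 1 ≤ X → 1 ≤ Y → Y ≤ X ^ σ →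
    (Set.ncard {f : ℤ × ℤ × ℤ × ℤ | 0 < f.1 ∧ 0 ≤ f.2.1 ∧ f.2.1 < 3 * f.1 ∧
        ((|f.2.1 ^ 2 - 3 * f.1 * f.2.2.1| : ℤ) : ℝ) ≤ Y ^ (1 / 3 : ℝ) ∧
        ((|2 * f.2.1 ^ 3 - 9 * f.1 * f.2.1 * f.2.2.1 + 27 * f.1 ^ 2 * f.2.2.2| : ℤ) : ℝ)
          ≤ 2 * Y ^ (1 / 2 : ℝ) ∧
        f.2.1 ^ 2 * f.2.2.1 ^ 2 - 4 * f.1 * f.2.2.1 ^ 3 - 4 * f.2.1 ^ 3 * f.2.2.2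
          - 27 * f.1 ^ 2 * f.2.2.2 ^ 2 + 18 * f.1 * f.2.1 * f.2.2.1 * f.2.2.2 ≠ 0 ∧
        ((∏ p ∈ (f.1.natAbs * (f.2.1 ^ 2 * f.2.2.1 ^ 2 - 4 * f.1 * f.2.2.1 ^ 3
            - 4 * f.2.1 ^ 3 * f.2.2.2 - 27 * f.1 ^ 2 * f.2.2.2 ^ 2
            + 18 * f.1 * f.2.1 * f.2.2.1 * f.2.2.2).natAbs).primeFactors, p : ℕ) : ℝ) ≤ X}
      : ℝ) ≤ C * X ^ ε * (X * Y ^ (-(1 / 6 : ℝ)) + 1)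

/-- The census set of `IndexFormCensus` at scales `(X, Y)` with the two real thresholds
`B₃ = Y^{1/3}`, `B₂ = 2 Y^{1/2}` made explicit. -/
def formSet (X B₃ B₂ : ℝ) : Set (ℤ × ℤ × ℤ × ℤ) :=
  {f : ℤ × ℤ × ℤ × ℤ | 0 < f.1 ∧ 0 ≤ f.2.1 ∧ f.2.1 < 3 * f.1 ∧
        ((|f.2.1 ^ 2 - 3 * f.1 * f.2.2.1| : ℤ) : ℝ) ≤ B₃ ∧
        ((|2 * f.2.1 ^ 3 - 9 * f.1 * f.2.1 * f.2.2.1 + 27 * f.1 ^ 2 * f.2.2.2| : ℤ) : ℝ) ≤ B₂ ∧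
        f.2.1 ^ 2 * f.2.2.1 ^ 2 - 4 * f.1 * f.2.2.1 ^ 3 - 4 * f.2.1 ^ 3 * f.2.2.2
          - 27 * f.1 ^ 2 * f.2.2.2 ^ 2 + 18 * f.1 * f.2.1 * f.2.2.1 * f.2.2.2 ≠ 0 ∧
        ((∏ p ∈ (f.1.natAbs * (f.2.1 ^ 2 * f.2.2.1 ^ 2 - 4 * f.1 * f.2.2.1 ^ 3
            - 4 * f.2.1 ^ 3 * f.2.2.2 - 27 * f.1 ^ 2 * f.2.2.2 ^ 2
            + 18 * f.1 * f.2.1 * f.2.2.1 * f.2.2.2).natAbs).primeFactors, p : ℕ) : ℝ) ≤ X}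

/-- The census set is finite: the syzygy `4H³ − G² = 27a²·Disc` with `Disc ≠ 0` bounds `a`,
then `0 ≤ b < 3a`, and `c`, `d` are pinned by the covariant bounds. -/
lemma formSet_finite (X B₃ B₂ : ℝ) : (formSet X B₃ B₂).Finite := by
  have hK0 : (0 : ℝ) ≤ 4 * |B₃| ^ 3 + B₂ ^ 2 := by positivity
  obtain ⟨K, hK, hK1⟩ : ∃ K : ℝ, 4 * |B₃| ^ 3 + B₂ ^ 2 + 1 ≤ K ∧ 1 ≤ K :=
    ⟨_, le_rfl, by linarith only [hK0]⟩
  have hKpos : 0 < K := by linarith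
  obtain ⟨L, hL⟩ : ∃ L : ℝ,
      |B₂| + 54 * K ^ 3 + 27 * K ^ 2 * (9 * K ^ 2 + |B₃|) + (9 * K ^ 2 + |B₃|) + 3 * K ≤ L :=
    ⟨_, le_rfl⟩
  have hL1 : 0 ≤ |B₂| := abs_nonneg _
  have hL2 : 0 ≤ 54 * K ^ 3 := by positivity
  have hL3 : 0 ≤ 27 * K ^ 2 * (9 * K ^ 2 + |B₃|) := by positivity
  have hL4 : 0 ≤ 9 * K ^ 2 + |B₃| := by positivity
  obtain ⟨N, hLN⟩ : ∃ N : ℕ, L ≤ N := ⟨Nat.ceil L, Nat.le_ceil L⟩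
  have hIfin : (Set.Icc (-(N : ℤ)) N).Finite := Set.finite_Icc _ _
  have key : ∀ z : ℤ, |(z : ℝ)| ≤ L → z ∈ Set.Icc (-(N : ℤ)) N := by
    intro z hz
    have hz' : |(z : ℝ)| ≤ N := hz.trans hLN
    have hz'' : |z| ≤ (N : ℤ) := by exact_mod_cast hz'
    exact ⟨(abs_le.mp hz'').1, (abs_le.mp hz'').2⟩
  refine (hIfin.prod (hIfin.prod (hIfin.prod hIfin))).subset ?_
  rintro ⟨a, b, c, d⟩ h
  simp only [formSet, Set.mem_setOf_eq] at h
  obtain ⟨ha, hb0, hb3, hH, hG, hD, -⟩ := h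
  simp only [Set.mem_prod]
  -- real versions of the hypotheses
  have haR : (1 : ℝ) ≤ a := by exact_mod_cast (show (1 : ℤ) ≤ a by omega)
  have hb0R : (0 : ℝ) ≤ b := by exact_mod_cast hb0
  have hb3R : (b : ℝ) ≤ 3 * a := by exact_mod_cast hb3.le
  have eH : ((b ^ 2 - 3 * a * c : ℤ) : ℝ) = (b : ℝ) ^ 2 - 3 * a * c := by push_cast; ring
  have eG : ((2 * b ^ 3 - 9 * a * b * c + 27 * a ^ 2 * d : ℤ) : ℝ)
      = 2 * (b : ℝ) ^ 3 - 9 * a * b * c + 27 * a ^ 2 * d := by push_cast; ring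
  have eD : ((b ^ 2 * c ^ 2 - 4 * a * c ^ 3 - 4 * b ^ 3 * d - 27 * a ^ 2 * d ^ 2
        + 18 * a * b * c * d : ℤ) : ℝ)
      = (b : ℝ) ^ 2 * c ^ 2 - 4 * a * c ^ 3 - 4 * b ^ 3 * d - 27 * a ^ 2 * d ^ 2
        + 18 * a * b * c * d := by push_cast; ring
  have hHb : |(b : ℝ) ^ 2 - 3 * a * c| ≤ B₃ := by rw [← eH, ← Int.cast_abs]; exact hH
  have hGb : |2 * (b : ℝ) ^ 3 - 9 * a * b * c + 27 * a ^ 2 * d| ≤ B₂ := by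
    rw [← eG, ← Int.cast_abs]; exact hG
  have hD1 : (1 : ℝ) ≤ |(b : ℝ) ^ 2 * c ^ 2 - 4 * a * c ^ 3 - 4 * b ^ 3 * d - 27 * a ^ 2 * d ^ 2
        + 18 * a * b * c * d| := by
    rw [← eD, ← Int.cast_abs]
    exact_mod_cast Int.one_le_abs hD
  clear eH eG eD hH hG hD
  -- the syzygy
  have syz : 4 * ((b : ℝ) ^ 2 - 3 * a * c) ^ 3 - (2 * (b : ℝ) ^ 3 - 9 * a * b * c + 27 * a ^ 2 * d) ^ 2
      = (27 * (a : ℝ) ^ 2) * ((b : ℝ) ^ 2 * c ^ 2 - 4 * a * c ^ 3 - 4 * b ^ 3 * d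
        - 27 * a ^ 2 * d ^ 2 + 18 * a * b * c * d) := by ring
  have hH3 : |(b : ℝ) ^ 2 - 3 * a * c| ^ 3 ≤ |B₃| ^ 3 := by
    have := hHb.trans (le_abs_self B₃)
    gcongr
  have hG2 : (2 * (b : ℝ) ^ 3 - 9 * a * b * c + 27 * a ^ 2 * d) ^ 2 ≤ B₂ ^ 2 := by
    have := pow_le_pow_left₀ (abs_nonneg _) hGb 2
    rwa [sq_abs] at this
  have ha2 : 27 * (a : ℝ) ^ 2 ≤ 4 * |B₃| ^ 3 + B₂ ^ 2 := by
    have h27 : (0 : ℝ) ≤ 27 * (a : ℝ) ^ 2 := by positivity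
    have h1 : 27 * (a : ℝ) ^ 2 ≤ 27 * (a : ℝ) ^ 2 *
        |(b : ℝ) ^ 2 * c ^ 2 - 4 * a * c ^ 3 - 4 * b ^ 3 * d - 27 * a ^ 2 * d ^ 2
          + 18 * a * b * c * d| := le_mul_of_one_le_right h27 hD1
    have h2 : 27 * (a : ℝ) ^ 2 *
        |(b : ℝ) ^ 2 * c ^ 2 - 4 * a * c ^ 3 - 4 * b ^ 3 * d - 27 * a ^ 2 * d ^ 2
          + 18 * a * b * c * d|
        = |4 * ((b : ℝ) ^ 2 - 3 * a * c) ^ 3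
            - (2 * (b : ℝ) ^ 3 - 9 * a * b * c + 27 * a ^ 2 * d) ^ 2| := by
      rw [syz, abs_mul, abs_of_nonneg h27]
    have h3 : |4 * ((b : ℝ) ^ 2 - 3 * a * c) ^ 3
            - (2 * (b : ℝ) ^ 3 - 9 * a * b * c + 27 * a ^ 2 * d) ^ 2|
        ≤ 4 * |(b : ℝ) ^ 2 - 3 * a * c| ^ 3
            + (2 * (b : ℝ) ^ 3 - 9 * a * b * c + 27 * a ^ 2 * d) ^ 2 := by
      refine (abs_sub _ _).trans (le_of_eq ?_)
      rw [abs_mul, abs_pow, abs_pow, sq_abs]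
      norm_num
    linarith only [h1, h2, h3, hH3, hG2]
  clear syz hD1
  have haK : (a : ℝ) ≤ K := by
    have : (a : ℝ) ≤ (a : ℝ) ^ 2 := le_self_pow₀ haR (by norm_num)
    linarith only [this, ha2, hK, sq_nonneg (a : ℝ)]
  have hbK : (b : ℝ) ≤ 3 * K := by linarith only [hb3R, haK]
  -- coordinate bounds
  have haL : |(a : ℝ)| ≤ L := by
    rw [abs_of_pos (by linarith only [haR])]
    linarith only [haK, hL, hL1, hL2, hL3, hL4, hKpos]
  have hbL : |(b : ℝ)| ≤ L := by
    rw [abs_of_nonneg hb0R]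
    linarith only [hbK, hL, hL1, hL2, hL3, hL4, hKpos]
  have hcB : |(c : ℝ)| ≤ 9 * K ^ 2 + |B₃| := by
    have h1 : |3 * (a : ℝ) * c| = 3 * a * |(c : ℝ)| := by
      rw [abs_mul, abs_of_pos (by positivity : (0 : ℝ) < 3 * a)]
    have h2 : |3 * (a : ℝ) * c| ≤ (b : ℝ) ^ 2 + |B₃| := by
      have e : 3 * (a : ℝ) * c = (b : ℝ) ^ 2 - ((b : ℝ) ^ 2 - 3 * a * c) := by ring
      rw [e]
      refine (abs_sub _ _).trans ?_
      rw [abs_pow, sq_abs]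
      linarith only [hHb.trans (le_abs_self B₃)]
    have h3 : (b : ℝ) ^ 2 ≤ (3 * K) ^ 2 := pow_le_pow_left₀ hb0R hbK 2
    have h3' : (3 * K) ^ 2 = 9 * K ^ 2 := by ring
    have h4 : |(c : ℝ)| ≤ 3 * a * |(c : ℝ)| :=
      le_mul_of_one_le_left (abs_nonneg _) (by linarith only [haR])
    linarith only [h1, h2, h3, h3', h4]
  have hcL : |(c : ℝ)| ≤ L := by linarith only [hcB, hL, hL1, hL2, hL3, hKpos]
  have hdL : |(d : ℝ)| ≤ L := by
    have h1 : |27 * (a : ℝ) ^ 2 * d| = 27 * a ^ 2 * |(d : ℝ)| := by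
      rw [abs_mul, abs_of_pos (by positivity : (0 : ℝ) < 27 * a ^ 2)]
    have h2 : |27 * (a : ℝ) ^ 2 * d| ≤ |B₂| + 2 * (b : ℝ) ^ 3 + 9 * a * b * |(c : ℝ)| := by
      have e : 27 * (a : ℝ) ^ 2 * (d : ℝ)
          = (2 * (b : ℝ) ^ 3 - 9 * (a : ℝ) * (b : ℝ) * (c : ℝ) + 27 * (a : ℝ) ^ 2 * (d : ℝ))
            - 2 * (b : ℝ) ^ 3 + 9 * (a : ℝ) * (b : ℝ) * (c : ℝ) := by
        ring
      rw [e]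
      have i1 := abs_add_le ((2 * (b : ℝ) ^ 3 - 9 * (a : ℝ) * (b : ℝ) * (c : ℝ)
          + 27 * (a : ℝ) ^ 2 * (d : ℝ)) - 2 * (b : ℝ) ^ 3) (9 * (a : ℝ) * (b : ℝ) * (c : ℝ))
      have i2 := abs_sub (2 * (b : ℝ) ^ 3 - 9 * (a : ℝ) * (b : ℝ) * (c : ℝ)
          + 27 * (a : ℝ) ^ 2 * (d : ℝ)) (2 * (b : ℝ) ^ 3)
      have i3 : |2 * (b : ℝ) ^ 3| = 2 * (b : ℝ) ^ 3 := abs_of_nonneg (by positivity)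
      have i4 : |9 * (a : ℝ) * b * c| = 9 * a * b * |(c : ℝ)| := by
        rw [abs_mul, abs_of_nonneg (by positivity : (0 : ℝ) ≤ 9 * a * b)]
      linarith only [i1, i2, i3, i4, hGb.trans (le_abs_self B₂)]
    have h3 : (b : ℝ) ^ 3 ≤ (3 * K) ^ 3 := pow_le_pow_left₀ hb0R hbK 3
    have h3' : (3 * K) ^ 3 = 27 * K ^ 3 := by ring
    have h4 : 9 * (a : ℝ) * b * |(c : ℝ)| ≤ 9 * K * (3 * K) * (9 * K ^ 2 + |B₃|) := by
      gcongr
    have h5 : |(d : ℝ)| ≤ 27 * a ^ 2 * |(d : ℝ)| :=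
      le_mul_of_one_le_left (abs_nonneg _) (by nlinarith only [haR])
    have h6 : 9 * K * (3 * K) * (9 * K ^ 2 + |B₃|) = 27 * K ^ 2 * (9 * K ^ 2 + |B₃|) := by ring
    linarith only [h1, h2, h3, h3', h4, h5, h6, hL, hL4, hKpos]
  exact ⟨key a haL, key b hbL, key c hcL, key d hdL⟩

theorem not_IndexFormCensus (σ : ℝ) (hσ : 6 ≤ σ) : ¬ IndexFormCensus σ := by
  intro h
  obtain ⟨C, hC⟩ := h (1 / 12) (by norm_num)
  obtain ⟨k, hkC, hk2⟩ : ∃ k : ℕ, 2 * C + 2 < k ∧ 2 ≤ k := by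
    refine ⟨Nat.ceil (2 * C) + 3, ?_, by omega⟩
    push_cast
    linarith [Nat.le_ceil (2 * C)]
  have hk1R : (1 : ℝ) ≤ k := by exact_mod_cast (by omega : 1 ≤ k)
  have hkR : (0 : ℝ) < k := by positivity
  have hX1 : (1 : ℝ) ≤ (k : ℝ) ^ 12 := one_le_pow₀ hk1R
  have hY1 : (1 : ℝ) ≤ (k : ℝ) ^ 72 := one_le_pow₀ hk1R
  have hYX : (k : ℝ) ^ 72 ≤ ((k : ℝ) ^ 12) ^ σ := by
    calc (k : ℝ) ^ 72 = ((k : ℝ) ^ 12) ^ ((6 : ℕ) : ℝ) := by rw [Real.rpow_natCast]; ring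
      _ ≤ ((k : ℝ) ^ 12) ^ σ :=
          Real.rpow_le_rpow_of_exponent_le hX1 (by exact_mod_cast hσ)
  have hmain := hC ((k : ℝ) ^ 12) ((k : ℝ) ^ 72) hX1 hY1 hYX
  have e1 : ((k : ℝ) ^ 12) ^ ((1 : ℝ) / 12) = (k : ℝ) := by
    rw [show ((1 : ℝ) / 12) = ((12 : ℕ) : ℝ)⁻¹ by norm_num]
    have := rpow_pow_inv k 1 12 (by norm_num)
    simpa using this
  have e2 : ((k : ℝ) ^ 72) ^ (-(1 / 6 : ℝ)) = ((k : ℝ) ^ 12)⁻¹ := by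
    rw [Real.rpow_neg (by positivity), show ((1 : ℝ) / 6) = ((6 : ℕ) : ℝ)⁻¹ by norm_num,
      show (k : ℝ) ^ 72 = ((k : ℝ) ^ 12) ^ 6 by ring]
    rw [rpow_pow_inv k 12 6 (by norm_num)]
  have e3 : (k : ℝ) ^ 12 * ((k : ℝ) ^ 12)⁻¹ = 1 := mul_inv_cancel₀ (by positivity)
  have e4 : ((k : ℝ) ^ 72) ^ ((1 : ℝ) / 3) = (k : ℝ) ^ 24 := by
    rw [show ((1 : ℝ) / 3) = ((3 : ℕ) : ℝ)⁻¹ by norm_num,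
      show (k : ℝ) ^ 72 = ((k : ℝ) ^ 24) ^ 3 by ring]
    exact rpow_pow_inv k 24 3 (by norm_num)
  rw [e1, e2, e3, e4] at hmain
  have hmain' : ((formSet ((k : ℝ) ^ 12) ((k : ℝ) ^ 24) (2 * ((k : ℝ) ^ 72) ^ ((1 : ℝ) / 2))).ncard : ℝ)
      ≤ C * k * (1 + 1) := hmain
  -- witness family `(1, 0, -m, 0)`, `1 ≤ m ≤ k³`
  let f : ℤ → ℤ × ℤ × ℤ × ℤ := fun m => (1, 0, -m, 0)
  let F : Finset (ℤ × ℤ × ℤ × ℤ) := (Finset.Icc (1 : ℤ) ((k : ℤ) ^ 3)).image f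
  have hFinj : Function.Injective f := fun a b hab => by
    simp only [f, Prod.mk.injEq] at hab; omega
  have hFcard : F.card = k ^ 3 := by
    rw [Finset.card_image_of_injective _ hFinj, Int.card_Icc,
      show ((k : ℤ)) ^ 3 + 1 - 1 = ((k ^ 3 : ℕ) : ℤ) by push_cast; ring]
    exact Int.toNat_natCast _
  have hkZ : (2 : ℤ) ≤ k := by exact_mod_cast hk2
  have hFsub : (F : Set (ℤ × ℤ × ℤ × ℤ)) ⊆
      formSet ((k : ℝ) ^ 12) ((k : ℝ) ^ 24) (2 * ((k : ℝ) ^ 72) ^ ((1 : ℝ) / 2)) := by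
    intro p hp
    simp only [F, Finset.coe_image, Finset.coe_Icc, Set.mem_image, Set.mem_Icc] at hp
    obtain ⟨m, ⟨hm1, hm2⟩, rfl⟩ := hp
    simp only [formSet, Set.mem_setOf_eq, f]
    refine ⟨by norm_num, le_rfl, by norm_num, ?_, ?_, ?_, ?_⟩
    · -- |H(1,0)| = 3m ≤ k²⁴
      have : |(0 : ℤ) ^ 2 - 3 * 1 * -m| ≤ (k : ℤ) ^ 24 := by
        rw [show (0 : ℤ) ^ 2 - 3 * 1 * -m = 3 * m by ring, abs_of_nonneg (by omega)]
        calc 3 * m ≤ 3 * (k : ℤ) ^ 3 := by linarith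
          _ ≤ (k : ℤ) ^ 21 * (k : ℤ) ^ 3 := by
              gcongr
              exact le_trans (by norm_num) (pow_le_pow_left₀ (by norm_num) hkZ 21)
          _ = (k : ℤ) ^ 24 := by ring
      exact_mod_cast this
    · -- |G(1,0)| = 0
      norm_num
      positivity
    · -- Disc = 4 m³ ≠ 0
      ring_nf
      positivity
    · -- rad(1 · 4m³) ≤ 4m³ ≤ k¹²
      have hdisc : (0 : ℤ) ^ 2 * (-m) ^ 2 - 4 * 1 * (-m) ^ 3 - 4 * 0 ^ 3 * 0 - 27 * 1 ^ 2 * 0 ^ 2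
          + 18 * 1 * 0 * -m * 0 = 4 * m ^ 3 := by ring
      rw [hdisc]
      have hm0 : (4 * m ^ 3).natAbs ≠ 0 := by
        rw [ne_eq, Int.natAbs_eq_zero]; positivity
      have h1 : (1 : ℤ).natAbs * (4 * m ^ 3).natAbs = (4 * m ^ 3).natAbs := by simp
      rw [h1]
      have hle : (∏ p ∈ (4 * m ^ 3).natAbs.primeFactors, p) ≤ (4 * m ^ 3).natAbs :=
        Nat.le_of_dvd (Nat.pos_of_ne_zero hm0) (Nat.prod_primeFactors_dvd _)
      have hle' : ((4 * m ^ 3).natAbs : ℤ) ≤ (k : ℤ) ^ 12 := by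
        rw [Int.natAbs_of_nonneg (by positivity)]
        calc 4 * m ^ 3 ≤ 4 * ((k : ℤ) ^ 3) ^ 3 := by gcongr
          _ = 4 * (k : ℤ) ^ 9 := by ring
          _ ≤ (k : ℤ) ^ 3 * (k : ℤ) ^ 9 := by
              have hk3 : (4 : ℤ) ≤ (k : ℤ) ^ 3 :=
                le_trans (by norm_num) (pow_le_pow_left₀ (by norm_num) hkZ 3)
              gcongr
          _ = (k : ℤ) ^ 12 := by ring
      have : ((∏ p ∈ (4 * m ^ 3).natAbs.primeFactors, p : ℕ) : ℤ) ≤ (k : ℤ) ^ 12 :=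
        le_trans (by exact_mod_cast hle) hle'
      exact_mod_cast this
  have hle := Set.ncard_le_ncard hFsub (formSet_finite _ _ _)
  rw [Set.ncard_coe_finset, hFcard] at hle
  have hleR : (k : ℝ) ^ 3 ≤ C * k * (1 + 1) := by
    calc (k : ℝ) ^ 3 = ((k ^ 3 : ℕ) : ℝ) := by push_cast; ring
      _ ≤ _ := by exact_mod_cast hle
      _ ≤ C * k * (1 + 1) := hmain'
  have hk2R : (2 : ℝ) ≤ k := by exact_mod_cast hk2
  have hsq : (k : ℝ) ^ 2 * k ≤ 2 * C * k := by nlinarith [hleR]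
  have hsq' : (k : ℝ) ^ 2 ≤ 2 * C := le_of_mul_le_mul_right hsq hkR
  nlinarith

end CruxTriage.R1K2
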